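import Literature.MathematicalPhysics.QuantumFieldTheory.Balaban1983to89.HiggsCovariance

/-!
# `Balaban1983to89.HiggsCovariancePos` — T. Bałaban, *(Higgs)₂,₃ quantum fields in a finite volume. I. A lower bound*,
Commun. Math. Phys. **85** (1982) 603–626 [Balaban1982Higgs1], p. 605 (1.11) and pp. 609–610 (2.17), (2.20): the
covariant Laplace operator IS `D^{ε*}_A D^ε_A`, the averaging operator `Q_k(A)` and `Q_k^*(A)` ARE adjoint, and the
operator `−Δ^{ε,N}_{A,Ω} + m² + a_k(L^kε)^{−2}P_k(A)` inverted in (2.20) IS positive definite — so the propagator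
`G^ε_k(Ω, A)` of (2.20) EXISTS (the typer's `HiggsCovariance.propagatorK`, an inverse in the endomorphism ring, is a
genuine two-sided inverse) — PROVED for the concrete carriers `…HiggsLattice` / `…HiggsAveraging` / `…HiggsCovariance`

statement-level skeleton of published theorems with citation tags; proofs where landed; nothing here is a claim about the Yang–Mills mass gap

PDF held: `paper:balaban1982-cmp85-higgs23-i` (journal page = PDF page + 602).  Sentences and displays read from the ×2
renders `run/shared/lean/pub/pub-balaban/b2b-balaban-ref1/pages/1982-cmp85-higgs23-I/1982-cmp85-higgs23-I-p003,
p007, p008-x2.png` (pp. 605, 609, 610), never from the OCR layer.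

CITATION HEADER (lean-in-tree rule).  lit-balaban typed skeleton (HOME `run/shared/lean/pub/lit-balaban/`), carrier API
for SKELETON rows **B1.Eq1.11** (the action (1.11), `HiggsLattice.action`/`covLaplaceForm`), **B1.Eq2.17** ((2.17)
`Δ^{(0)} = −Δ^{ε,N}_{A,Ω} + m²`, `HiggsCovariance.covLaplacianN`/`delta0`) and **B1.Eq2.20** ((2.20) `G^ε_k(Ω,A)`,
`P_k(A) = Q_k^*(A)Q_k(A)`: `HiggsCovariance.avgQkAdj`/`projPk`/`covOpK`/`propagatorK`) — owners r01/r14; rows of record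
unchanged.  The module `HiggsCovariance` DEFINED these operators and said in its docstrings what they are
(*"the self-adjoint operator of the quadratic form Σ_{b⊂Ω} η^d|(D^η_Aφ)(b)|²"*, *"the adjoint Q_k^*(A) … the weights
combine to 1"*, *"invertibility for m² > 0 … is a STATEMENT, not assumed here"*); this module PROVES those three
statements.  WHAT IS REPRODUCED: p. 605, verbatim: *"−Δ^ε_A = D^{ε*}_A D^ε_A is the covariant Laplace operator"* —
`siteInner_covLaplacianN_univ` (`⟨ψ, (−Δ^η_A)φ⟩ = ⟨D^η_Aψ, D^η_Aφ⟩` for the scalar products (1.5) on sites and bonds) and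
`siteInner_covLaplacianN_univ_self` (`⟨φ, (−Δ^η_A)φ⟩ = Σ_b η^d|(D^η_Aφ)(b)|²` = `HiggsLattice.covLaplaceForm`, the term
of (1.11)); p. 609, verbatim: *"−Δ^{ε,N}_{A,Ω} is a covariant Laplace operator on the set Ω with Neumann boundary
conditions"* — `siteInner_covLaplacianN` (`⟨ψ, (−Δ^{η,N}_{A,Ω})φ⟩ = Σ_{b⊂Ω} η^d⟨(D^η_Aψ)(b), (D^η_Aφ)(b)⟩`, only the
bonds with both ends in `Ω`), whence `0 ≤ ⟨φ, (−Δ^{η,N}_{A,Ω})φ⟩`; p. 610 (2.20), verbatim: *"P_k(A) = Q_k^*(A)Q_k(A)"* with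
`Q_k^*` THE ADJOINT — `siteInner_avgQk` (`⟨Q_k(A)f, ψ⟩_{T^{(k)}} = ⟨f, Q_k^*(A)ψ⟩_{T_ε}` for the scalar products (1.5) of
the two lattices, weights `(L^kε)^d` and `ε^d`), `siteInner_projPk` (`⟨φ, P_k(A)φ⟩ = ⟨Q_k(A)φ, Q_k(A)φ⟩ ≥ 0`); and the
EXISTENCE of (2.20) *"G^ε_k(Ω, A) = (−Δ^{ε,N}_{A,Ω} + m² + a_k(L^kε)^{−2}P_k(A))^{−1}"*: for `m² > 0` and `a_k ≥ 0` the
operator is coercive (`siteInner_covOpK_ge`: `⟨φ, (…)φ⟩ ≥ m²⟨φ, φ⟩`), hence injective, hence — an endomorphism of a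
finite-dimensional space — a unit (`isUnit_covOpK`), and `propagatorK` is its two-sided inverse (`propagatorK_mul_covOpK`,
`covOpK_mul_propagatorK`, applied forms `propagatorK_covOpK_apply`, `covOpK_propagatorK_apply`); `a_k > 0` for `a > 0`,
`L > 1`, `k ≥ 1` is the tree's `B1.aSeq_pos` ((2.15)), packaged as `isUnit_covOpK_of_pos`.
DELIBERATELY NOT HERE: the bounds of Propositions 2.1–2.3 on the kernels `G_k(Ω, A; x, x')` (rows B1.Prop2.1–2.3, typed
over `B4.EtaSetting` in `…Balaban1983to89.B1`); (2.18)–(2.19), (2.21) (rows B1.Eq2.17/2.21, `B1RG242`).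
Unit `lit-balaban-typer` gen 3 (literature-prover-lit-balaban-typer-g3-0); HOME/FILED.md records the proposal.
-/

open scoped BigOperators InnerProductSpace

namespace Literature.MathematicalPhysics.QuantumFieldTheory.Balaban1983to89.HiggsCovariancePos

open Literature.MathematicalPhysics.QuantumFieldTheory.Balaban1983to89.HiggsLattice
open Literature.MathematicalPhysics.QuantumFieldTheory.Balaban1983to89.HiggsAveraging
open Literature.MathematicalPhysics.QuantumFieldTheory.Balaban1983to89.HiggsCovariance

variable {P : Params} {k N : ℕ}

/-! ## 1. Torus bookkeeping: `x ↦ x ± ηe_μ` are inverse bijections; sums over bonds -/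

section Torus

/-- `(x − ηe_μ) + ηe_μ = x` on the torus `T^{(k)}` ((1.2) p. 604, periodic labels). [cite: Balaban1982Higgs1, (1.2) p.604] -/
@[simp] theorem shift_unshift (x : Site P k) (μ : Fin P.d) : (x.unshift μ).shift μ = x := by
  funext ν
  by_cases h : ν = μ
  · subst h
    simp [Site.shift, Site.unshift]
  · simp [Site.shift, Site.unshift, h]

/-- `(x + ηe_μ) − ηe_μ = x` on the torus `T^{(k)}`. [cite: Balaban1982Higgs1, (1.2) p.604] -/
@[simp] theorem unshift_shift (x : Site P k) (μ : Fin P.d) : (x.shift μ).unshift μ = x := by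
  funext ν
  by_cases h : ν = μ
  · subst h
    simp [Site.shift, Site.unshift]
  · simp [Site.shift, Site.unshift, h]

/-- Translation by `ηe_μ` as a permutation of the sites of `T^{(k)}`. [cite: Balaban1982Higgs1, (1.2) p.604] -/
def shiftEquiv (P : Params) (k : ℕ) (μ : Fin P.d) : Site P k ≃ Site P k :=
  ⟨fun x => x.shift μ, fun x => x.unshift μ, fun x => unshift_shift x μ, fun x => shift_unshift x μ⟩

/-- A sum over sites and directions is a sum over the positively oriented bonds `⟨x, x + ηe_μ⟩` (p. 604). [cite: Balaban1982Higgs1, (1.4) p.604] -/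
theorem sum_site_dir {M : Type*} [AddCommMonoid M] (f : Site P k → Fin P.d → M) :
    ∑ x : Site P k, ∑ μ : Fin P.d, f x μ = ∑ b : PBond P k, f b.src b.dir := by
  rw [← Finset.sum_product']
  exact Fintype.sum_equiv ⟨fun p => ⟨p.1, p.2⟩, fun b => (b.src, b.dir), fun _ => rfl, fun _ => rfl⟩ _ _
    (fun _ => rfl)

end Torus

/-! ## 2. p. 605: `−Δ^η_A = D^{η*}_A D^η_A`; p. 609: the Neumann form on `Ω` -/

section Laplacian

/-- The set of bonds lying INSIDE `Ω` (both endpoints in `Ω`; p. 609: Neumann boundary conditions keep exactly these). [cite: Balaban1982Higgs1, (2.17) p.610] -/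
def Inside (Ω : Finset (Site P k)) (b : PBond P k) : Prop := b.src ∈ Ω ∧ b.tgt ∈ Ω

/-- Membership of a bond in the inside of a finite set of sites is decidable. [folklore] -/
instance (Ω : Finset (Site P k)) : DecidablePred (Inside Ω) := fun b =>
  inferInstanceAs (Decidable (b.src ∈ Ω ∧ b.tgt ∈ Ω))

/-- Unitarity of the transports in the form used below: `⟨U u, U v⟩ = ⟨u, v⟩` (p. 605). [cite: Balaban1982Higgs1, (1.7) p.605] -/
theorem inner_U_U (C : ChargeData N) (η a : ℝ) (u v : E N) : ⟪C.U η a u, C.U η a v⟫_ℝ = ⟪u, v⟫_ℝ := by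
  have hu := C.U_mem_unitary η a
  rw [← ContinuousLinearMap.adjoint_inner_left, ← ContinuousLinearMap.star_eq_adjoint]
  change ⟪(star (C.U η a) * C.U η a) u, v⟫_ℝ = ⟪u, v⟫_ℝ
  rw [Unitary.star_mul_self_of_mem hu]
  all_goals simp

/-- `⟨u, U* v⟩ = ⟨U u, v⟩` (the adjoint; `U* = U(−A)`, p. 605). [cite: Balaban1982Higgs1, (1.7) p.605] -/
theorem inner_star_U (C : ChargeData N) (η a : ℝ) (u v : E N) :
    ⟪u, star (C.U η a) v⟫_ℝ = ⟪C.U η a u, v⟫_ℝ := by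
  rw [ContinuousLinearMap.star_eq_adjoint, ContinuousLinearMap.adjoint_inner_right]

/-- The bond identity behind `−Δ_A = D_A^*D_A`: for one bond `b` with transport `U = U(A_b)`,
`⟨ψ(b₋), φ(b₋) − Uφ(b₊)⟩ + ⟨ψ(b₊), φ(b₊) − U*φ(b₋)⟩ = ⟨Uψ(b₊) − ψ(b₋), Uφ(b₊) − φ(b₋)⟩` (unitarity of `U`). PROVED. [cite: Balaban1982Higgs1, (1.11) p.605] -/
theorem bond_identity (C : ChargeData N) (η a : ℝ) (ψm ψp φm φp : E N) :
    ⟪ψm, φm - C.U η a φp⟫_ℝ + ⟪ψp, φp - star (C.U η a) φm⟫_ℝ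
      = ⟪C.U η a ψp - ψm, C.U η a φp - φm⟫_ℝ := by
  rw [inner_sub_right, inner_sub_right, inner_sub_left, inner_sub_right, inner_sub_right, inner_U_U, inner_star_U,
    real_inner_comm (C.U η a φp) ψm]
  ring

/-- **p. 609, the Neumann form**: `⟨ψ, (−Δ^{η,N}_{A,Ω})φ⟩ = Σ_{b ⊂ Ω} η^d ⟨(D^η_Aψ)(b), (D^η_Aφ)(b)⟩` — the operator
`HiggsCovariance.covLaplacianN` is the operator of the covariant Dirichlet form restricted to the bonds inside `Ω`,
for the scalar products (1.5). PROVED (reindex the backward terms by `x ↦ x + ηe_μ`, then the bond identity). [cite: Balaban1982Higgs1, (2.17) p.610] -/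
theorem siteInner_covLaplacianN (C : ChargeData N) (Ω : Finset (Site P k)) (A : VecField P k)
    (ψ φ : ScalarField P k N) :
    siteInner ψ (covLaplacianN C Ω A φ)
      = ∑ b : PBond P k, if Inside Ω b then P.mesh k ^ P.d * ⟪covDeriv C A ψ b, covDeriv C A φ b⟫_ℝ else 0 := by
  -- Step 1: unfold the operator pointwise.
  have happ : ∀ x : Site P k, covLaplacianN C Ω A φ x
      = ((P.mesh k)⁻¹ ^ 2) • ∑ μ : Fin P.d, (fwdTerm C Ω A x μ φ + bwdTerm C Ω A x μ φ) := by
    intro x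
    simp only [covLaplacianN, LinearMap.pi_apply, LinearMap.smul_apply, LinearMap.coe_sum, Finset.sum_apply,
      LinearMap.add_apply]
  have hfwd : ∀ (x : Site P k) (μ : Fin P.d), fwdTerm C Ω A x μ φ
      = if x ∈ Ω ∧ x.shift μ ∈ Ω then φ x - C.U (P.mesh k) (A ⟨x, μ⟩) (φ (x.shift μ)) else 0 := by
    intro x μ
    unfold fwdTerm
    split_ifs <;> simp
  have hbwd : ∀ (x : Site P k) (μ : Fin P.d), bwdTerm C Ω A x μ φ
      = if x ∈ Ω ∧ x.unshift μ ∈ Ω then φ x - star (C.U (P.mesh k) (A ⟨x.unshift μ, μ⟩)) (φ (x.unshift μ))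
        else 0 := by
    intro x μ
    unfold bwdTerm
    split_ifs <;> simp
  -- Step 2: the forward part as a sum over bonds.
  have hF : ∑ x : Site P k, ∑ μ : Fin P.d, ⟪ψ x, fwdTerm C Ω A x μ φ⟫_ℝ
      = ∑ b : PBond P k, if b.src ∈ Ω ∧ b.src.shift b.dir ∈ Ω then
          ⟪ψ b.src, φ b.src - C.U (P.mesh k) (A ⟨b.src, b.dir⟩) (φ (b.src.shift b.dir))⟫_ℝ else 0 := by
    rw [sum_site_dir]
    refine Finset.sum_congr rfl fun b _ => ?_
    rw [hfwd]
    split_ifs <;> simp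
  -- Step 3: the backward part, reindexed by `x = y + ηe_μ`.
  have hB : ∑ x : Site P k, ∑ μ : Fin P.d, ⟪ψ x, bwdTerm C Ω A x μ φ⟫_ℝ
      = ∑ b : PBond P k, if b.src.shift b.dir ∈ Ω ∧ b.src ∈ Ω then
          ⟪ψ (b.src.shift b.dir), φ (b.src.shift b.dir) - star (C.U (P.mesh k) (A ⟨b.src, b.dir⟩)) (φ b.src)⟫_ℝ
        else 0 := by
    rw [Finset.sum_comm]
    have hμ : ∀ μ : Fin P.d, ∑ x : Site P k, ⟪ψ x, bwdTerm C Ω A x μ φ⟫_ℝ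
        = ∑ y : Site P k, ⟪ψ (y.shift μ), bwdTerm C Ω A (y.shift μ) μ φ⟫_ℝ :=
      fun μ => (Equiv.sum_comp (shiftEquiv P k μ) (fun x => ⟪ψ x, bwdTerm C Ω A x μ φ⟫_ℝ)).symm
    simp_rw [hμ]
    rw [Finset.sum_comm, sum_site_dir]
    refine Finset.sum_congr rfl fun b _ => ?_
    rw [hbwd, unshift_shift]
    split_ifs <;> simp
  -- Step 4: assemble.
  have hx : ∀ x : Site P k,
      P.mesh k ^ P.d * ⟪ψ x, ((P.mesh k)⁻¹ ^ 2) • ∑ μ : Fin P.d, (fwdTerm C Ω A x μ φ + bwdTerm C Ω A x μ φ)⟫_ℝ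
        = P.mesh k ^ P.d * (P.mesh k)⁻¹ ^ 2
          * (∑ μ : Fin P.d, ⟪ψ x, fwdTerm C Ω A x μ φ⟫_ℝ + ∑ μ : Fin P.d, ⟪ψ x, bwdTerm C Ω A x μ φ⟫_ℝ) := by
    intro x
    rw [real_inner_smul_right, inner_sum, ← Finset.sum_add_distrib]
    simp_rw [inner_add_right]
    ring
  unfold siteInner
  simp_rw [happ, hx]
  rw [← Finset.mul_sum, Finset.sum_add_distrib, hF, hB, ← Finset.sum_add_distrib, Finset.mul_sum]
  refine Finset.sum_congr rfl fun b _ => ?_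
  have heta : (⟨b.src, b.dir⟩ : PBond P k) = b := rfl
  rw [heta]
  simp only [Inside, PBond.tgt]
  by_cases h1 : b.src ∈ Ω <;> by_cases h2 : b.src.shift b.dir ∈ Ω
  · simp only [h1, h2, and_self, if_true]
    rw [bond_identity]
    simp only [covDeriv, PBond.tgt, real_inner_smul_left, real_inner_smul_right]
    ring
  · simp [h1, h2]
  · simp [h1, h2]
  · simp [h1, h2]

/-- **p. 605: `−Δ^η_A = D^{η*}_A D^η_A`** — on the whole torus (`Ω = T^{(k)}`):
`⟨ψ, (−Δ^η_A)φ⟩ = ⟨D^η_Aψ, D^η_Aφ⟩` for the scalar products (1.5) on sites (`siteInner`) and on bonds (`bondInner`). PROVED. [cite: Balaban1982Higgs1, (1.11) p.605] -/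
theorem siteInner_covLaplacianN_univ (C : ChargeData N) (A : VecField P k) (ψ φ : ScalarField P k N) :
    siteInner ψ (covLaplacianN C Finset.univ A φ) = bondInner (covDeriv C A ψ) (covDeriv C A φ) := by
  rw [siteInner_covLaplacianN]
  unfold bondInner Inside
  exact Finset.sum_congr rfl fun b _ => by simp

/-- **(1.11) p. 605**: `⟨φ, (−Δ^η_A)φ⟩ = Σ_b η^d |(D^η_Aφ)(b)|²` — the covariant kinetic term of the action (1.11) written
with the operator is the tree's `HiggsLattice.covLaplaceForm`. PROVED. [cite: Balaban1982Higgs1, (1.11) p.605] -/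
theorem siteInner_covLaplacianN_univ_self (C : ChargeData N) (A : VecField P k) (φ : ScalarField P k N) :
    siteInner φ (covLaplacianN C Finset.univ A φ) = covLaplaceForm C A φ := by
  rw [siteInner_covLaplacianN_univ]
  unfold bondInner covLaplaceForm
  exact Finset.sum_congr rfl fun b _ => by rw [real_inner_self_eq_norm_sq]

/-- **`−Δ^{η,N}_{A,Ω} ≥ 0`**: `0 ≤ ⟨φ, (−Δ^{η,N}_{A,Ω})φ⟩ = Σ_{b⊂Ω} η^d|(D^η_Aφ)(b)|²` (p. 609: a Laplace operator with
Neumann boundary conditions). PROVED. [cite: Balaban1982Higgs1, (2.17) p.610] -/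
theorem siteInner_covLaplacianN_nonneg (C : ChargeData N) (Ω : Finset (Site P k)) (A : VecField P k)
    (φ : ScalarField P k N) : 0 ≤ siteInner φ (covLaplacianN C Ω A φ) := by
  rw [siteInner_covLaplacianN]
  refine Finset.sum_nonneg fun b _ => ?_
  split_ifs
  · rw [real_inner_self_eq_norm_sq]
    exact mul_nonneg (pow_nonneg (P.mesh_pos k).le _) (sq_nonneg _)
  · exact le_rfl

/-- The Neumann form is symmetric: `⟨ψ, (−Δ^{η,N}_{A,Ω})φ⟩ = ⟨φ, (−Δ^{η,N}_{A,Ω})ψ⟩` (p. 609: a self-adjoint operator). PROVED. [cite: Balaban1982Higgs1, (2.17) p.610] -/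
theorem siteInner_covLaplacianN_comm (C : ChargeData N) (Ω : Finset (Site P k)) (A : VecField P k)
    (ψ φ : ScalarField P k N) :
    siteInner ψ (covLaplacianN C Ω A φ) = siteInner φ (covLaplacianN C Ω A ψ) := by
  rw [siteInner_covLaplacianN, siteInner_covLaplacianN]
  exact Finset.sum_congr rfl fun b _ => by rw [real_inner_comm]

end Laplacian

/-! ## 3. (2.20) p. 610: `Q_k^*(A)` is the adjoint of `Q_k(A)`; `P_k(A) = Q_k^*(A)Q_k(A) ≥ 0` -/

section Adjoint

/-- **(2.20): `Q_k^*(A)` IS the adjoint of `Q_k(A)`** for the scalar products (1.5) of the two lattices: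
`⟨Q_k(A)f, ψ⟩_{T^{(k)}}` (weight `(L^kε)^d`) `= ⟨f, Q_k^*(A)ψ⟩_{T_ε}` (weight `ε^d`) — the weights `(L^kε)^d · L^{−kd} = ε^d`
combine as announced in `HiggsCovariance.avgQkAdj`. PROVED (fibrewise summation over the blocks `B^k(y)`). [cite: Balaban1982Higgs1, (2.20) p.610] -/
theorem siteInner_avgQk (C : ChargeData N) (A : VecField P 0) (k : ℕ) (f : ScalarField P 0 N)
    (ψ : ScalarField P k N) :
    siteInner (avgQk C A k f) ψ = siteInner f (avgQkAdj C A k ψ) := by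
  have hadj : ∀ x : Site P 0, avgQkAdj C A k ψ x = star (C.U (P.mesh 0) (multiContourSum A k x)) (ψ (blockIter k x)) := by
    intro x
    simp [avgQkAdj]
  have hw : P.mesh k ^ P.d * ((P.L : ℝ) ^ (k * P.d))⁻¹ = P.mesh 0 ^ P.d := by
    have hL : (0 : ℝ) < (P.L : ℝ) ^ (k * P.d) := pow_pos (by exact_mod_cast P.hL) _
    unfold Params.mesh
    rw [pow_zero, one_mul, mul_pow, ← pow_mul, mul_assoc, mul_comm (P.ε ^ P.d), ← mul_assoc,
      mul_inv_cancel₀ hL.ne', one_mul]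
  unfold siteInner
  simp_rw [avgQk_apply, real_inner_smul_left, sum_inner, hadj, inner_star_U]
  -- fibrewise: Σ_y Σ_{x ∈ B^k(y)} = Σ_x
  have hfib : ∑ y : Site P k, ∑ x ∈ blockK k y,
        P.mesh 0 ^ P.d * ⟪C.U (P.mesh 0) (multiContourSum A k x) (f x), ψ (blockIter k x)⟫_ℝ
      = ∑ x : Site P 0, P.mesh 0 ^ P.d * ⟪C.U (P.mesh 0) (multiContourSum A k x) (f x), ψ (blockIter k x)⟫_ℝ := by
    unfold blockK
    exact Finset.sum_fiberwise Finset.univ (blockIter k)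
      (fun x => P.mesh 0 ^ P.d * ⟪C.U (P.mesh 0) (multiContourSum A k x) (f x), ψ (blockIter k x)⟫_ℝ)
  rw [← hfib]
  refine Finset.sum_congr rfl fun y _ => ?_
  rw [← mul_assoc, hw, Finset.mul_sum]
  refine Finset.sum_congr rfl fun x hx => ?_
  rw [(mem_blockK k y x).mp hx]

/-- `Q_k(A)` as the linear map `avgQkLin` has the same adjointness. [cite: Balaban1982Higgs1, (2.20) p.610] -/
theorem siteInner_avgQkLin (C : ChargeData N) (A : VecField P 0) (k : ℕ) (f : ScalarField P 0 N)
    (ψ : ScalarField P k N) :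
    siteInner (avgQkLin C A k f) ψ = siteInner f (avgQkAdj C A k ψ) := by
  have h : avgQkLin C A k f = avgQk C A k f := funext fun y => avgQkLin_apply C A k f y
  rw [h, siteInner_avgQk]

/-- **(2.20): `⟨φ, P_k(A)φ⟩ = ⟨Q_k(A)φ, Q_k(A)φ⟩`** (`P_k(A) = Q_k^*(A)Q_k(A)`). PROVED. [cite: Balaban1982Higgs1, (2.20) p.610] -/
theorem siteInner_projPk (C : ChargeData N) (A : VecField P 0) (k : ℕ) (φ : ScalarField P 0 N) :
    siteInner φ (projPk C A k φ) = siteInner (avgQkLin C A k φ) (avgQkLin C A k φ) := by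
  unfold projPk
  rw [LinearMap.comp_apply, ← siteInner_avgQkLin]

/-- The scalar product (1.5) of a field with itself is `Σ_x η^d|f(x)|² ≥ 0`. [cite: Balaban1982Higgs1, (1.5) p.604] -/
theorem siteInner_self_eq {j M : ℕ} (f : ScalarField P j M) : siteInner f f = ∑ x : Site P j, P.mesh j ^ P.d * ‖f x‖ ^ 2 := by
  unfold siteInner
  exact Finset.sum_congr rfl fun x _ => by rw [real_inner_self_eq_norm_sq]

/-- `⟨f, f⟩ ≥ 0` for the scalar product (1.5). [cite: Balaban1982Higgs1, (1.5) p.604] -/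
theorem siteInner_self_nonneg {j M : ℕ} (f : ScalarField P j M) : 0 ≤ siteInner f f := by
  rw [siteInner_self_eq]
  exact Finset.sum_nonneg fun x _ => mul_nonneg (pow_nonneg (P.mesh_pos j).le _) (sq_nonneg _)

/-- **`P_k(A) ≥ 0`**: `0 ≤ ⟨φ, P_k(A)φ⟩`. PROVED. [cite: Balaban1982Higgs1, (2.20) p.610] -/
theorem siteInner_projPk_nonneg (C : ChargeData N) (A : VecField P 0) (k : ℕ) (φ : ScalarField P 0 N) :
    0 ≤ siteInner φ (projPk C A k φ) := by
  rw [siteInner_projPk]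
  exact siteInner_self_nonneg _

end Adjoint

/-! ## 4. (2.20) p. 610: the operator `−Δ^{ε,N}_{A,Ω} + m² + a_k(L^kε)^{−2}P_k(A)` is positive definite; `G^ε_k(Ω,A)` exists -/

section Propagator

/-- **Coercivity of the operator of (2.20)**: for `a_k ≥ 0`,
`⟨φ, (−Δ^{ε,N}_{A,Ω} + m² + a_k(L^kε)^{−2}P_k(A))φ⟩ ≥ m²⟨φ, φ⟩` (the Laplacian and `P_k` terms are non-negative). PROVED. [cite: Balaban1982Higgs1, (2.20) p.610] -/
theorem siteInner_covOpK_ge (C : ChargeData N) (Ω : Finset (Site P 0)) (A : VecField P 0) (msq a : ℝ) (k : ℕ)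
    (hak : 0 ≤ B1.aSeq a P.L k) (φ : ScalarField P 0 N) :
    msq * siteInner φ φ ≤ siteInner φ (covOpK C Ω A msq a k φ) := by
  have hsplit : siteInner φ (covOpK C Ω A msq a k φ)
      = siteInner φ (covLaplacianN C Ω A φ) + msq * siteInner φ φ
        + (B1.aSeq a P.L k * ((P.mesh k)⁻¹ ^ 2)) * siteInner φ (projPk C A k φ) := by
    unfold covOpK siteInner
    simp only [LinearMap.add_apply, LinearMap.smul_apply, LinearMap.id_coe, id_eq, Pi.add_apply, Pi.smul_apply,
      inner_add_right, real_inner_smul_right, mul_add, Finset.sum_add_distrib, Finset.mul_sum]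
    congr 1
    · congr 1
      exact Finset.sum_congr rfl fun x _ => by ring
    · exact Finset.sum_congr rfl fun x _ => by ring
  rw [hsplit]
  have h1 := siteInner_covLaplacianN_nonneg C Ω A φ
  have h2 : 0 ≤ (B1.aSeq a P.L k * ((P.mesh k)⁻¹ ^ 2)) * siteInner φ (projPk C A k φ) :=
    mul_nonneg (mul_nonneg hak (sq_nonneg _)) (siteInner_projPk_nonneg C A k φ)
  linarith

/-- A field with `⟨φ, φ⟩ = 0` vanishes (all weights `ε^d > 0`). [cite: Balaban1982Higgs1, (1.5) p.604] -/
theorem eq_zero_of_siteInner_self_eq_zero {j M : ℕ} (f : ScalarField P j M) (h : siteInner f f = 0) : f = 0 := by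
  rw [siteInner_self_eq] at h
  have hterm : ∀ x ∈ (Finset.univ : Finset (Site P j)), P.mesh j ^ P.d * ‖f x‖ ^ 2 = 0 :=
    (Finset.sum_eq_zero_iff_of_nonneg fun x _ => mul_nonneg (pow_nonneg (P.mesh_pos j).le _) (sq_nonneg _)).mp h
  funext x
  have hx := hterm x (Finset.mem_univ x)
  rcases mul_eq_zero.mp hx with h0 | h0
  · exact absurd h0 (pow_ne_zero _ (P.mesh_pos j).ne')
  · exact norm_eq_zero.mp ((pow_eq_zero_iff two_ne_zero).mp h0)

/-- **The operator of (2.20) is injective** for `m² > 0`, `a_k ≥ 0`. PROVED. [cite: Balaban1982Higgs1, (2.20) p.610] -/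
theorem covOpK_injective (C : ChargeData N) (Ω : Finset (Site P 0)) (A : VecField P 0) {msq : ℝ} (hmsq : 0 < msq)
    (a : ℝ) (k : ℕ) (hak : 0 ≤ B1.aSeq a P.L k) : Function.Injective (covOpK C Ω A msq a k) := by
  refine (injective_iff_map_eq_zero _).mpr fun φ hφ => ?_
  have hge := siteInner_covOpK_ge C Ω A msq a k hak φ
  rw [hφ] at hge
  have hzero : siteInner φ (0 : ScalarField P 0 N) = 0 := by simp [siteInner]
  rw [hzero] at hge
  have hnn := siteInner_self_nonneg φ
  have h0 : siteInner φ φ = 0 := by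
    by_contra hne
    have hpos : 0 < siteInner φ φ := lt_of_le_of_ne hnn (Ne.symm hne)
    have := mul_pos hmsq hpos
    linarith
  exact eq_zero_of_siteInner_self_eq_zero φ h0

/-- **(2.20) EXISTS: the operator `−Δ^{ε,N}_{A,Ω} + m² + a_k(L^kε)^{−2}P_k(A)` is a unit** of the endomorphism ring of the
fields on `T_ε` for `m² > 0`, `a_k ≥ 0` (injective endomorphism of a finite-dimensional space). PROVED. [cite: Balaban1982Higgs1, (2.20) p.610] -/
theorem isUnit_covOpK (C : ChargeData N) (Ω : Finset (Site P 0)) (A : VecField P 0) {msq : ℝ} (hmsq : 0 < msq)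
    (a : ℝ) (k : ℕ) (hak : 0 ≤ B1.aSeq a P.L k) : IsUnit (covOpK C Ω A msq a k) := by
  rw [LinearMap.isUnit_iff_ker_eq_bot]
  exact LinearMap.ker_eq_bot.mpr (covOpK_injective C Ω A hmsq a k hak)

/-- The hypotheses as the paper has them: `a > 0`, `L > 1` (p. 604, p. 609) give `a_k > 0` for `k ≥ 1` (`B1.aSeq_pos`,
(2.15)), so (2.20) exists for every `m² > 0`. [cite: Balaban1982Higgs1, (2.20) p.610] -/
theorem isUnit_covOpK_of_pos (C : ChargeData N) (Ω : Finset (Site P 0)) (A : VecField P 0) {msq a : ℝ}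
    (hmsq : 0 < msq) (ha : 0 < a) (hL : 1 < (P.L : ℝ)) {k : ℕ} (hk : 1 ≤ k) : IsUnit (covOpK C Ω A msq a k) :=
  isUnit_covOpK C Ω A hmsq a k (B1.aSeq_pos ha hL hk).le

/-- **`G^ε_k(Ω, A)` is a left inverse**: `G^ε_k(Ω,A) ∘ (−Δ^{ε,N}_{A,Ω} + m² + a_k(L^kε)^{−2}P_k(A)) = 1`. PROVED. [cite: Balaban1982Higgs1, (2.20) p.610] -/
theorem propagatorK_mul_covOpK (C : ChargeData N) (Ω : Finset (Site P 0)) (A : VecField P 0) {msq : ℝ}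
    (hmsq : 0 < msq) (a : ℝ) (k : ℕ) (hak : 0 ≤ B1.aSeq a P.L k) :
    propagatorK C Ω A msq a k * covOpK C Ω A msq a k = 1 :=
  Ring.inverse_mul_cancel _ (isUnit_covOpK C Ω A hmsq a k hak)

/-- **`G^ε_k(Ω, A)` is a right inverse**: `(−Δ^{ε,N}_{A,Ω} + m² + a_k(L^kε)^{−2}P_k(A)) ∘ G^ε_k(Ω,A) = 1`. PROVED. [cite: Balaban1982Higgs1, (2.20) p.610] -/
theorem covOpK_mul_propagatorK (C : ChargeData N) (Ω : Finset (Site P 0)) (A : VecField P 0) {msq : ℝ}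
    (hmsq : 0 < msq) (a : ℝ) (k : ℕ) (hak : 0 ≤ B1.aSeq a P.L k) :
    covOpK C Ω A msq a k * propagatorK C Ω A msq a k = 1 :=
  Ring.mul_inverse_cancel _ (isUnit_covOpK C Ω A hmsq a k hak)

/-- Applied form: `G^ε_k(Ω,A)((−Δ + m² + a_kℓ^{−2}P_k)φ) = φ`. [cite: Balaban1982Higgs1, (2.20) p.610] -/
theorem propagatorK_covOpK_apply (C : ChargeData N) (Ω : Finset (Site P 0)) (A : VecField P 0) {msq : ℝ}
    (hmsq : 0 < msq) (a : ℝ) (k : ℕ) (hak : 0 ≤ B1.aSeq a P.L k) (φ : ScalarField P 0 N) :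
    propagatorK C Ω A msq a k (covOpK C Ω A msq a k φ) = φ := by
  have h := congrArg (fun T : Module.End ℝ (ScalarField P 0 N) => T φ) (propagatorK_mul_covOpK C Ω A hmsq a k hak)
  simpa using h

/-- Applied form: `(−Δ + m² + a_kℓ^{−2}P_k)(G^ε_k(Ω,A)ψ) = ψ` — `G^ε_kψ` SOLVES the equation defining the propagator. [cite: Balaban1982Higgs1, (2.20) p.610] -/
theorem covOpK_propagatorK_apply (C : ChargeData N) (Ω : Finset (Site P 0)) (A : VecField P 0) {msq : ℝ}
    (hmsq : 0 < msq) (a : ℝ) (k : ℕ) (hak : 0 ≤ B1.aSeq a P.L k) (ψ : ScalarField P 0 N) :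
    covOpK C Ω A msq a k (propagatorK C Ω A msq a k ψ) = ψ := by
  have h := congrArg (fun T : Module.End ℝ (ScalarField P 0 N) => T ψ) (covOpK_mul_propagatorK C Ω A hmsq a k hak)
  simpa using h

/-- **`G^ε_k(Ω, A) ≥ 0`**: `0 ≤ ⟨G^ε_kψ, ψ⟩` (indeed `≥ m²|G^ε_kψ|²`), from the coercivity applied to `φ = G^ε_kψ`. PROVED. [cite: Balaban1982Higgs1, (2.20) p.610] -/
theorem siteInner_propagatorK_nonneg (C : ChargeData N) (Ω : Finset (Site P 0)) (A : VecField P 0) {msq : ℝ}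
    (hmsq : 0 < msq) (a : ℝ) (k : ℕ) (hak : 0 ≤ B1.aSeq a P.L k) (ψ : ScalarField P 0 N) :
    0 ≤ siteInner (propagatorK C Ω A msq a k ψ) ψ := by
  have h := siteInner_covOpK_ge C Ω A msq a k hak (propagatorK C Ω A msq a k ψ)
  rw [covOpK_propagatorK_apply C Ω A hmsq a k hak] at h
  exact le_trans (mul_nonneg hmsq.le (siteInner_self_nonneg _)) h

end Propagator

end Literature.MathematicalPhysics.QuantumFieldTheory.Balaban1983to89.HiggsCovariancePos
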